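/-
Copyright (c) 2026 the pub-hodgecm-mathlib formalisation cell (harness21).  Prover seat hodgecm-mathlib-F0P3-p04 (g14): road «S3-ram» (LEAD F0P3a-plan (g12∕g13); owner
F0P3a-p06 (g15); junction pen F0P3a-p01 (g17)), junction (J★) v2-iso socket S1 «THE REGION IS UP-CLOSED»; 2026-09-02.
-/
import Literature.NumberTheory.Automorphic.UnitaryLatticeTreeFixedGrandchildrenCountRamified   -- ★ G3⁺ p847297: `latticeGraphIso_eq_iff_mapGL_eq`; brings ★ LevelShift, ★ StarOfInvolution, ★ SelfDualTransitiveTame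
import Literature.NumberTheory.Automorphic.UnitaryLatticeTreeFramesOfInvolution                 -- ★ `isTree_latticeGraph_three_of_neg`, frames `exists_frame_mapGL_stdLattice∕_N₁`; brings ★ IsTreeOfInvolution (parent specs)
import Literature.NumberTheory.Automorphic.UnitaryLatticeTreeFixedVertex                        -- ★ `scaleLattice_scaleLattice`, `scaleLattice_mono`
import HarnessLib

/-!
# The lattice graph of a hermitian space — THE LEVEL TOKEN `LEV(ϖ^d)` IS UP-CLOSED TOWARDS THE ROOT (tame-ramified `U(3)` tree)
# (Bruhat–Tits 1972 §10; Serre, *Trees* II.1.1; Kottwitz 1986 §3)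

Topic `NumberTheory/Automorphic`; namespace `Literature.NumberTheory.Automorphic.UnitaryLatticeTree`.  THEOREMS ONLY (no definition, no instance, no notation, no named fact,
no `sorry`); kernel lane `--supports stmt-HodgeConjecture-24833`.  Cell `pub/hodgecm-mathlib` (D-0151), crux H413; road «S3-ram» (Literature seeding, count-neutral), junction
(J★) of the type-(1) ramified organ (Σ)′, ISOCELES wave (F0P3a-p01 (g17) skeleton v4 `JunctionSockets.skeleton.v4` e89e5e06e7d3b45d): socket **S1 `row_regionUpClosed`** —
«a fixed self-dual vertex one of whose fixed grandchildren carries `LEV(ϖ^d₀)` carries it too».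

THE MATHEMATICS.  `K` a valued field with isometric involution `σ`, uniformiser `ϖ` with `σϖ = −ϖ` (tame-ramified: `hres`, `|2| = 1`, `hnorm`), `J₀ = antidiag(1,1,1)` on `K³`,
`G` the lattice graph (a tree, ★ `isTree_latticeGraph_three_of_neg`), root `r₀ = L₀ = 𝒪³`.  For `γ ∈ U(J₀)` and a lattice `M` write `LEV[M](c)` for `(γ − 1)·M ≤ c·M`.
(§1) ROOTED DICTIONARY: in any graph with a depth function `d` (`d r = 0`) and a parent map `p` (`v ~ p v`, `d (p v) + 1 = d v`) such that every edge is a parent edge,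
`dist(r, v) = d v` (climb the parent chain; along any walk `d` drops by at most one per step).  For the `U(3)` tree (★ R5c's data: `d` = `2·depth` on self-dual, `2·depth − 1`
on type-two vertices, `p = latticeParent`): `dist(r₀, v) = d v`, and for vertices `N < L`: `dist(r₀, N) = dist(r₀, L) + 1 ⇒ L = latticeParent N`, `dist(r₀, L) = dist(r₀, N) + 1
⇒ N = latticeParent L` (★ `eq_latticeParent_of_lt_of_frames` + the dictionary).  (§2) LEVEL ALGEBRA: `LEV` passes to homothetic lattices, to intersections, and — for `γ`
UNITARY with `γM = M` — to the DUAL lattice `M♯` (`⟨x, (γ−1)y⟩ = ⟨(γ⁻¹−1)x, y⟩` and `(γ⁻¹ − 1)M = −γ⁻¹(γ−1)M ≤ c·M`).  (§3) UP-CLOSED: let `v` be a fixed self-dual vertex, `c` a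
child of `v` and `w` a child of `c` (distances `+1`, `+2` from `r₀`), `LEV[w](ϖ^d)` and `LEV[r₀](ϖ^d)`.  By §1, `v = latticeParent c = c♯ ⊓ ϖ^{−k}L₀` and
`c = latticeParent w = w ⊓ ϖ^{−k}L₀` with `k + 1 = depth c = depth w`; hence `LEV[c]` (intersection of `LEV[w]` and `LEV[ϖ^{−k}L₀]`), `LEV[c♯]` (duality, `γc = c`), and
`LEV[v]` (intersection again) — no frame, no count, no residue field arithmetic.  (§4) THE SOCKET: with the junction's eigenframe `γ = A·diag(s)·A⁻¹`, `A ∈ GL₃(𝒪)`,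
`|s_i − 1| ≤ |ϖ|^{d₀}`, the root token `LEV[r₀](ϖ^{d₀})` holds (`γ − 1 = A·diag(s−1)·A⁻¹` has entries `≤ |ϖ|^{d₀}`), so §3 gives S1 verbatim (the isoceles binders `i₀ hiso hclose`
are part of the socket and unused).

EDITION 2 (append-only, same seat): §5 ORIENTATION — `exists_parent_grandparent_lev_of_frames` ∕ `_of_neg`: for a fixed self-dual `v ≠ r₀` with `LEV[v](c)` (and the root
token), the parent `p` and grandparent `g ≠ v` exist with `v ~ p ~ g`, `dist(r₀, p) + 1 = dist(r₀, v)` and `LEV[g](c)` (§3 on `(g, p, v)`, `p` fixed by ★ `parentClosed_fixedPoints`) —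
the `∃`-clause of the junction's L2 `orientation_of_rows` without any row.

HONEST LABEL: HC_CM is proved only modulo the 2 remaining named inputs (hLiu418 24832, h413 24833) until rung 0 closes; nothing printed is asserted here (rooted-tree bookkeeping
and lattice algebra over a valuation ring); «S3-ram» has no books consequence.

## References
* [BruhatTits1972] F. Bruhat, J. Tits, *Groupes réductifs sur un corps local I*, Publ. Math. IHÉS 41 (1972), §10 (lattice models; the rank-one building is a tree).
* [Serre1980Trees] J.-P. Serre, *Trees* (1980), Ch. I §2.2–2.3 (rooted trees, distance), Ch. II §1.1 (lattices, neighbours, distance from a base lattice).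
* [Kottwitz1986] R. E. Kottwitz, *Base change for unit elements of Hecke algebras*, Compositio Math. 60 (1986), §3 (fixed lattices of a congruence-level element).
* [Tits1979] J. Tits, *Reductive groups over local fields*, PSPM 33.1 (1979), §2.4, §3.5.
-/

set_option autoImplicit false

noncomputable section

open scoped Valued WithZero Matrix MatrixGroups

namespace Literature.NumberTheory.Automorphic.UnitaryLatticeTree

open Literature.NumberTheory.Automorphic Literature.NumberTheory.Automorphic.HermitianLattice
open Literature.NumberTheory.Automorphic.CartanUnique

/-! ## §1 The rooted dictionary `dist(r, ·) = depth label` -/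

section Graph

variable {V : Type*} {G : SimpleGraph V}

/-- **ROOTED DICTIONARY (abstract).**  If `d r = 0`, every `v ≠ r` is adjacent to `p v` with `d (p v) + 1 = d v`, and every edge is a parent edge, then `dist(r, v) = d v`
for every `v`. [cite: Serre1980Trees, I.2.2 Prop. 8, I.2.3] -/
theorem dist_eq_of_parent (r : V) (d : V → ℕ) (p : V → V) (h0 : d r = 0) (hp : ∀ v, v ≠ r → G.Adj v (p v) ∧ d (p v) + 1 = d v)
    (hedge : ∀ v w, G.Adj v w → (v ≠ r ∧ p v = w) ∨ (w ≠ r ∧ p w = v)) (v : V) : G.dist r v = d v := by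
  classical
  -- a walk of length `d v` from `v` to the root, climbing the parent chain
  have hup : ∀ n u, d u = n → ∃ W : G.Walk u r, W.length = n := by
    intro n
    induction n with
    | zero =>
      intro u hu
      by_cases hur : u = r
      · subst hur; exact ⟨SimpleGraph.Walk.nil, rfl⟩
      · have h := (hp u hur).2; omega
    | succ n ih =>
      intro u hu
      have hur : u ≠ r := by rintro rfl; omega
      obtain ⟨hadj, hd⟩ := hp u hur
      obtain ⟨W, hW⟩ := ih (p u) (by omega)
      exact ⟨SimpleGraph.Walk.cons hadj W, by rw [SimpleGraph.Walk.length_cons, hW]⟩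
  -- along any walk to the root, `d` drops by at most one per step
  have hdown : ∀ (u : V) (W : G.Walk u r), d u ≤ W.length := by
    intro u W
    induction W with
    | nil => simp [h0]
    | @cons a b _ hab W' ih =>
      have hab' : d a ≤ d b + 1 := by
        rcases hedge a b hab with ⟨ha, hpa⟩ | ⟨hb, hpb⟩
        · have h := (hp a ha).2; rw [hpa] at h; omega
        · have h := (hp b hb).2; rw [hpb] at h; omega
      rw [SimpleGraph.Walk.length_cons]
      exact hab'.trans (Nat.succ_le_succ (ih h0 hp hedge hup))
  obtain ⟨W, hW⟩ := hup (d v) v rfl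
  refine le_antisymm ?_ ?_
  · rw [SimpleGraph.dist_comm]; calc G.dist v r ≤ W.length := SimpleGraph.dist_le W
      _ = d v := hW
  · obtain ⟨W', hW'⟩ := (W.reachable).exists_walk_length_eq_dist
    rw [SimpleGraph.dist_comm, ← hW']
    exact hdown v W'

end Graph

/-! ## §1b The dictionary for the `U(3)` lattice tree (any isometric involution, given the frames; then tame-ramified) -/

variable {K : Type*} [Field K] [Valued K ℤᵐ⁰] {σ : K →+* K} {ϖ : K}

section Frames

open scoped Classical

/-- **THE ROOTED DATA OF THE `U(3)` LATTICE TREE** (★ R5c's `d`, `p`, made public): with `d v = 2·depth v` (self-dual) ∕ `2·depth v − 1` (type two) and `p = latticeParent`, every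
`v ≠ r₀` is adjacent to its parent, which is a vertex with `d (p v) + 1 = d v`, and every edge is a parent edge — GIVEN the frames `hfr₀`, `hfr₂` (★ `isTree_latticeGraph_three_of_frames`'s
binders). [cite: BruhatTits1972, §10] [cite: Serre1980Trees, II.1.1] -/
theorem parentData_of_frames (hσ : ∀ x, σ (σ x) = x) (hvσ : ∀ a, Valued.v (σ a) = Valued.v a) (hϖ : Valued.v ϖ = WithZero.exp (-1 : ℤ))
    (hfr₀ : ∀ L : Submodule 𝒪[K] (Fin 3 → K), IsSelfDualLattice σ ϖ ((StdForm.antidiagonal 3).over K) L → ∃ κ : unitaryGroupOfForm σ ((StdForm.antidiagonal 3).over K), κ ∈ unitaryInt σ ((StdForm.antidiagonal 3).over K) ∧ ∃ a : ℤ, L = mapGL (κ : GL (Fin 3) K) (latt (Matrix.diagonal ![ϖ ^ a, 1, ϖ ^ (-a)])))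
    (hfr₂ : ∀ M : Submodule 𝒪[K] (Fin 3 → K), IsVertexLattice σ ϖ ((StdForm.antidiagonal 3).over K) 2 M → ∃ κ : unitaryGroupOfForm σ ((StdForm.antidiagonal 3).over K), κ ∈ unitaryInt σ ((StdForm.antidiagonal 3).over K) ∧ ∃ κ'' : unitaryGroupOfForm σ ((StdForm.antidiagonal 3).over K), κ'' ∈ unitaryInt σ ((StdForm.antidiagonal 3).over K) ∧ ∃ a : ℕ, ∃ t : unitaryGroupOfForm σ ((StdForm.antidiagonal 3).over K), ((t : GL (Fin 3) K) : Matrix (Fin 3) (Fin 3) K) = Matrix.diagonal ![ϖ ^ (a : ℤ), 1, (σ ϖ) ^ (-(a : ℤ))] ∧ M = mapGL (κ : GL (Fin 3) K) (mapGL (t : GL (Fin 3) K) (mapGL (κ'' : GL (Fin 3) K) (latt (Matrix.diagonal ![(1 : K), 1, ϖ]))))) :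
    (∀ v : {M : Submodule 𝒪[K] (Fin 3 → K) // IsVertex σ ϖ ((StdForm.antidiagonal 3).over K) M}, v ≠ ⟨stdLattice K 3, 0, isSelfDualLattice_stdLattice_three_of_v hϖ⟩ →
      ∃ hP : IsVertex σ ϖ ((StdForm.antidiagonal 3).over K) (latticeParent σ ϖ ((StdForm.antidiagonal 3).over K) v.1),
        (latticeGraph σ ϖ ((StdForm.antidiagonal 3).over K)).Adj v ⟨latticeParent σ ϖ ((StdForm.antidiagonal 3).over K) v.1, hP⟩ ∧
        (if IsSelfDualLattice σ ϖ ((StdForm.antidiagonal 3).over K) (latticeParent σ ϖ ((StdForm.antidiagonal 3).over K) v.1) then 2 * latticeDepth ϖ (latticeParent σ ϖ ((StdForm.antidiagonal 3).over K) v.1)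
          else 2 * latticeDepth ϖ (latticeParent σ ϖ ((StdForm.antidiagonal 3).over K) v.1) - 1) + 1 =
        (if IsSelfDualLattice σ ϖ ((StdForm.antidiagonal 3).over K) v.1 then 2 * latticeDepth ϖ v.1 else 2 * latticeDepth ϖ v.1 - 1)) ∧
    (∀ v w : {M : Submodule 𝒪[K] (Fin 3 → K) // IsVertex σ ϖ ((StdForm.antidiagonal 3).over K) M}, v.1 < w.1 →
      (v ≠ ⟨stdLattice K 3, 0, isSelfDualLattice_stdLattice_three_of_v hϖ⟩ ∧ latticeParent σ ϖ ((StdForm.antidiagonal 3).over K) v.1 = w.1) ∨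
      (w ≠ ⟨stdLattice K 3, 0, isSelfDualLattice_stdLattice_three_of_v hϖ⟩ ∧ latticeParent σ ϖ ((StdForm.antidiagonal 3).over K) w.1 = v.1)) := by
  have hroot : IsSelfDualLattice σ ϖ ((StdForm.antidiagonal 3).over K) (stdLattice K 3) := isSelfDualLattice_stdLattice_three_of_v hϖ
  -- no lattice is both self-dual and of type two
  have hnot : ∀ M : Submodule 𝒪[K] (Fin 3 → K), IsVertexLattice σ ϖ ((StdForm.antidiagonal 3).over K) 2 M → ¬ IsSelfDualLattice σ ϖ ((StdForm.antidiagonal 3).over K) M :=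
    fun M h2 h0 => absurd (type_unique hvσ hϖ h2 h0) (by norm_num)
  refine ⟨fun v hv => ?_, fun v w hvw => ?_⟩
  · have hv0 : v.1 ≠ stdLattice K 3 := fun h => hv (Subtype.ext h)
    obtain ⟨d, hvd⟩ := v.2
    rcases type_eq_zero_or_two_of_isVertexLattice_three hvσ hϖ v_det_antidiagonal_three hvd with rfl | rfl
    · -- `v` self-dual, `v ≠ 𝒪³`: parent of type two, below `v`, same depth `≥ 1`
      obtain ⟨hk, hP2, hPlt, hdep⟩ := latticeParent_spec_of_isSelfDualLattice_of_frames hσ hvσ hϖ hfr₀ hvd hv0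
      refine ⟨⟨2, hP2⟩, ?_, ?_⟩
      · rw [latticeGraph_adj_iff]; exact Or.inr hPlt
      · rw [if_neg (hnot _ hP2), if_pos (show IsSelfDualLattice σ ϖ _ v.1 from hvd), hdep]; omega
    · -- `v` of type two: parent self-dual, above `v`, one depth up
      obtain ⟨hP0, hltP, hdep⟩ := latticeParent_spec_of_isVertexLattice_two_of_frames hσ hvσ hϖ hfr₂ hvd
      refine ⟨⟨0, hP0⟩, ?_, ?_⟩
      · rw [latticeGraph_adj_iff]; exact Or.inl hltP
      · rw [if_pos (show IsSelfDualLattice σ ϖ _ (latticeParent σ ϖ _ v.1) from hP0), if_neg (hnot _ hvd)]; omega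
  · rcases eq_latticeParent_of_lt_of_frames hσ hvσ hϖ hfr₀ hfr₂ v.2 w.2 hvw with hpar | ⟨hw0, hpar⟩
    · left
      have hv : v ≠ ⟨stdLattice K 3, 0, isSelfDualLattice_stdLattice_three_of_v hϖ⟩ := by
        intro h
        obtain ⟨d, hvd⟩ := v.2
        obtain ⟨d', hwd⟩ := w.2
        obtain ⟨rfl, -⟩ := type_of_lt_three hvσ hϖ v_det_antidiagonal_three hvd hwd hvw
        exact hnot _ hvd (by rw [show v.1 = stdLattice K 3 from congrArg Subtype.val h]; exact hroot)
      exact ⟨hv, hpar.symm⟩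
    · right
      exact ⟨fun h => hw0 (congrArg Subtype.val h), hpar.symm⟩

/-- **`dist(r₀, v) = 2·depth v` (self-dual) ∕ `2·depth v − 1` (type two)** in the `U(3)` lattice tree, given the frames (§1 on ★ R5c's rooted data). [cite: Serre1980Trees, II.1.1] [cite: BruhatTits1972, §10] -/
theorem dist_root_eq_of_frames (hσ : ∀ x, σ (σ x) = x) (hvσ : ∀ a, Valued.v (σ a) = Valued.v a) (hϖ : Valued.v ϖ = WithZero.exp (-1 : ℤ))
    (hfr₀ : ∀ L : Submodule 𝒪[K] (Fin 3 → K), IsSelfDualLattice σ ϖ ((StdForm.antidiagonal 3).over K) L → ∃ κ : unitaryGroupOfForm σ ((StdForm.antidiagonal 3).over K), κ ∈ unitaryInt σ ((StdForm.antidiagonal 3).over K) ∧ ∃ a : ℤ, L = mapGL (κ : GL (Fin 3) K) (latt (Matrix.diagonal ![ϖ ^ a, 1, ϖ ^ (-a)])))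
    (hfr₂ : ∀ M : Submodule 𝒪[K] (Fin 3 → K), IsVertexLattice σ ϖ ((StdForm.antidiagonal 3).over K) 2 M → ∃ κ : unitaryGroupOfForm σ ((StdForm.antidiagonal 3).over K), κ ∈ unitaryInt σ ((StdForm.antidiagonal 3).over K) ∧ ∃ κ'' : unitaryGroupOfForm σ ((StdForm.antidiagonal 3).over K), κ'' ∈ unitaryInt σ ((StdForm.antidiagonal 3).over K) ∧ ∃ a : ℕ, ∃ t : unitaryGroupOfForm σ ((StdForm.antidiagonal 3).over K), ((t : GL (Fin 3) K) : Matrix (Fin 3) (Fin 3) K) = Matrix.diagonal ![ϖ ^ (a : ℤ), 1, (σ ϖ) ^ (-(a : ℤ))] ∧ M = mapGL (κ : GL (Fin 3) K) (mapGL (t : GL (Fin 3) K) (mapGL (κ'' : GL (Fin 3) K) (latt (Matrix.diagonal ![(1 : K), 1, ϖ]))))) 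
    (v : {M : Submodule 𝒪[K] (Fin 3 → K) // IsVertex σ ϖ ((StdForm.antidiagonal 3).over K) M}) :
    (latticeGraph σ ϖ ((StdForm.antidiagonal 3).over K)).dist ⟨stdLattice K 3, 0, isSelfDualLattice_stdLattice_three_of_v hϖ⟩ v =
      (if IsSelfDualLattice σ ϖ ((StdForm.antidiagonal 3).over K) v.1 then 2 * latticeDepth ϖ v.1 else 2 * latticeDepth ϖ v.1 - 1) := by
  classical
  obtain ⟨hpar, hedge⟩ := parentData_of_frames hσ hvσ hϖ hfr₀ hfr₂
  let V := {M : Submodule 𝒪[K] (Fin 3 → K) // IsVertex σ ϖ ((StdForm.antidiagonal 3).over K) M}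
  let r : V := ⟨stdLattice K 3, 0, isSelfDualLattice_stdLattice_three_of_v hϖ⟩
  let dp : V → ℕ := fun v => if IsSelfDualLattice σ ϖ ((StdForm.antidiagonal 3).over K) v.1 then 2 * latticeDepth ϖ v.1 else 2 * latticeDepth ϖ v.1 - 1
  let p : V → V := fun v => if hv : IsVertex σ ϖ ((StdForm.antidiagonal 3).over K) (latticeParent σ ϖ ((StdForm.antidiagonal 3).over K) v.1) then
    ⟨latticeParent σ ϖ ((StdForm.antidiagonal 3).over K) v.1, hv⟩ else v
  have hpv : ∀ v : V, v ≠ r → (p v).1 = latticeParent σ ϖ ((StdForm.antidiagonal 3).over K) v.1 ∧ (latticeGraph σ ϖ ((StdForm.antidiagonal 3).over K)).Adj v (p v) ∧ dp (p v) + 1 = dp v := by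
    intro v hv
    obtain ⟨hP, hadj, hd⟩ := hpar v hv
    have hpv : p v = ⟨latticeParent σ ϖ ((StdForm.antidiagonal 3).over K) v.1, hP⟩ := dif_pos hP
    rw [hpv]
    exact ⟨rfl, hadj, hd⟩
  refine (dist_eq_of_parent r dp p ?_ (fun v hv => ((hpv v hv).2)) ?_ v).trans rfl
  · show (if IsSelfDualLattice σ ϖ ((StdForm.antidiagonal 3).over K) (stdLattice K 3) then 2 * latticeDepth ϖ (stdLattice K 3) else 2 * latticeDepth ϖ (stdLattice K 3) - 1) = 0
    rw [if_pos (isSelfDualLattice_stdLattice_three_of_v hϖ), latticeDepth_stdLattice]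
  · intro v w hvw
    rw [latticeGraph_adj_iff] at hvw
    rcases hvw with h | h
    · rcases hedge v w h with ⟨hv, hp⟩ | ⟨hw, hp⟩
      · exact Or.inl ⟨hv, Subtype.ext (by rw [(hpv v hv).1]; exact hp)⟩
      · exact Or.inr ⟨hw, Subtype.ext (by rw [(hpv w hw).1]; exact hp)⟩
    · rcases hedge w v h with ⟨hw, hp⟩ | ⟨hv, hp⟩
      · exact Or.inr ⟨hw, Subtype.ext (by rw [(hpv w hw).1]; exact hp)⟩
      · exact Or.inl ⟨hv, Subtype.ext (by rw [(hpv v hv).1]; exact hp)⟩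

/-- **The parent is one step closer to the root**: for a vertex `v ≠ r₀`, `latticeParent v` is a vertex adjacent to `v` with `dist(r₀, latticeParent v) + 1 = dist(r₀, v)`
(given the frames). [cite: Serre1980Trees, I.2.3, II.1.1] [cite: BruhatTits1972, §10] -/
theorem dist_root_latticeParent_of_frames (hσ : ∀ x, σ (σ x) = x) (hvσ : ∀ a, Valued.v (σ a) = Valued.v a) (hϖ : Valued.v ϖ = WithZero.exp (-1 : ℤ))
    (hfr₀ : ∀ L : Submodule 𝒪[K] (Fin 3 → K), IsSelfDualLattice σ ϖ ((StdForm.antidiagonal 3).over K) L → ∃ κ : unitaryGroupOfForm σ ((StdForm.antidiagonal 3).over K), κ ∈ unitaryInt σ ((StdForm.antidiagonal 3).over K) ∧ ∃ a : ℤ, L = mapGL (κ : GL (Fin 3) K) (latt (Matrix.diagonal ![ϖ ^ a, 1, ϖ ^ (-a)])))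
    (hfr₂ : ∀ M : Submodule 𝒪[K] (Fin 3 → K), IsVertexLattice σ ϖ ((StdForm.antidiagonal 3).over K) 2 M → ∃ κ : unitaryGroupOfForm σ ((StdForm.antidiagonal 3).over K), κ ∈ unitaryInt σ ((StdForm.antidiagonal 3).over K) ∧ ∃ κ'' : unitaryGroupOfForm σ ((StdForm.antidiagonal 3).over K), κ'' ∈ unitaryInt σ ((StdForm.antidiagonal 3).over K) ∧ ∃ a : ℕ, ∃ t : unitaryGroupOfForm σ ((StdForm.antidiagonal 3).over K), ((t : GL (Fin 3) K) : Matrix (Fin 3) (Fin 3) K) = Matrix.diagonal ![ϖ ^ (a : ℤ), 1, (σ ϖ) ^ (-(a : ℤ))] ∧ M = mapGL (κ : GL (Fin 3) K) (mapGL (t : GL (Fin 3) K) (mapGL (κ'' : GL (Fin 3) K) (latt (Matrix.diagonal ![(1 : K), 1, ϖ]))))) 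
    (v : {M : Submodule 𝒪[K] (Fin 3 → K) // IsVertex σ ϖ ((StdForm.antidiagonal 3).over K) M}) (hv : v ≠ ⟨stdLattice K 3, 0, isSelfDualLattice_stdLattice_three_of_v hϖ⟩) :
    ∃ hP : IsVertex σ ϖ ((StdForm.antidiagonal 3).over K) (latticeParent σ ϖ ((StdForm.antidiagonal 3).over K) v.1),
      (latticeGraph σ ϖ ((StdForm.antidiagonal 3).over K)).Adj v ⟨latticeParent σ ϖ ((StdForm.antidiagonal 3).over K) v.1, hP⟩ ∧
      (latticeGraph σ ϖ ((StdForm.antidiagonal 3).over K)).dist ⟨stdLattice K 3, 0, isSelfDualLattice_stdLattice_three_of_v hϖ⟩ ⟨latticeParent σ ϖ ((StdForm.antidiagonal 3).over K) v.1, hP⟩ + 1 =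
        (latticeGraph σ ϖ ((StdForm.antidiagonal 3).over K)).dist ⟨stdLattice K 3, 0, isSelfDualLattice_stdLattice_three_of_v hϖ⟩ v := by
  obtain ⟨hP, hadj, hd⟩ := (parentData_of_frames hσ hvσ hϖ hfr₀ hfr₂).1 v hv
  refine ⟨hP, hadj, ?_⟩
  rw [dist_root_eq_of_frames hσ hvσ hϖ hfr₀ hfr₂, dist_root_eq_of_frames hσ hvσ hϖ hfr₀ hfr₂]
  exact hd

/-- **EVERY EDGE IS A PARENT EDGE, read with distances**: for vertices `N < L`, either `dist(r₀, N) = dist(r₀, L) + 1` and `L = latticeParent N`, or `dist(r₀, L) = dist(r₀, N) + 1`,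
`L ≠ r₀` and `N = latticeParent L` (given the frames). [cite: Serre1980Trees, II.1.1] [cite: BruhatTits1972, §10] -/
theorem eq_latticeParent_of_lt_of_dist_of_frames (hσ : ∀ x, σ (σ x) = x) (hvσ : ∀ a, Valued.v (σ a) = Valued.v a) (hϖ : Valued.v ϖ = WithZero.exp (-1 : ℤ))
    (hfr₀ : ∀ L : Submodule 𝒪[K] (Fin 3 → K), IsSelfDualLattice σ ϖ ((StdForm.antidiagonal 3).over K) L → ∃ κ : unitaryGroupOfForm σ ((StdForm.antidiagonal 3).over K), κ ∈ unitaryInt σ ((StdForm.antidiagonal 3).over K) ∧ ∃ a : ℤ, L = mapGL (κ : GL (Fin 3) K) (latt (Matrix.diagonal ![ϖ ^ a, 1, ϖ ^ (-a)])))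
    (hfr₂ : ∀ M : Submodule 𝒪[K] (Fin 3 → K), IsVertexLattice σ ϖ ((StdForm.antidiagonal 3).over K) 2 M → ∃ κ : unitaryGroupOfForm σ ((StdForm.antidiagonal 3).over K), κ ∈ unitaryInt σ ((StdForm.antidiagonal 3).over K) ∧ ∃ κ'' : unitaryGroupOfForm σ ((StdForm.antidiagonal 3).over K), κ'' ∈ unitaryInt σ ((StdForm.antidiagonal 3).over K) ∧ ∃ a : ℕ, ∃ t : unitaryGroupOfForm σ ((StdForm.antidiagonal 3).over K), ((t : GL (Fin 3) K) : Matrix (Fin 3) (Fin 3) K) = Matrix.diagonal ![ϖ ^ (a : ℤ), 1, (σ ϖ) ^ (-(a : ℤ))] ∧ M = mapGL (κ : GL (Fin 3) K) (mapGL (t : GL (Fin 3) K) (mapGL (κ'' : GL (Fin 3) K) (latt (Matrix.diagonal ![(1 : K), 1, ϖ]))))) 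
    {N L : {M : Submodule 𝒪[K] (Fin 3 → K) // IsVertex σ ϖ ((StdForm.antidiagonal 3).over K) M}} (hlt : N.1 < L.1) :
    ((latticeGraph σ ϖ ((StdForm.antidiagonal 3).over K)).dist ⟨stdLattice K 3, 0, isSelfDualLattice_stdLattice_three_of_v hϖ⟩ N =
        (latticeGraph σ ϖ ((StdForm.antidiagonal 3).over K)).dist ⟨stdLattice K 3, 0, isSelfDualLattice_stdLattice_three_of_v hϖ⟩ L + 1 ∧
      L.1 = latticeParent σ ϖ ((StdForm.antidiagonal 3).over K) N.1) ∨
    ((latticeGraph σ ϖ ((StdForm.antidiagonal 3).over K)).dist ⟨stdLattice K 3, 0, isSelfDualLattice_stdLattice_three_of_v hϖ⟩ L =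
        (latticeGraph σ ϖ ((StdForm.antidiagonal 3).over K)).dist ⟨stdLattice K 3, 0, isSelfDualLattice_stdLattice_three_of_v hϖ⟩ N + 1 ∧
      L ≠ ⟨stdLattice K 3, 0, isSelfDualLattice_stdLattice_three_of_v hϖ⟩ ∧ N.1 = latticeParent σ ϖ ((StdForm.antidiagonal 3).over K) L.1) := by
  rcases (parentData_of_frames hσ hvσ hϖ hfr₀ hfr₂).2 N L hlt with ⟨hN, hp⟩ | ⟨hL, hp⟩
  · left
    obtain ⟨hP, -, hd⟩ := dist_root_latticeParent_of_frames hσ hvσ hϖ hfr₀ hfr₂ N hN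
    have hPL : (⟨latticeParent σ ϖ ((StdForm.antidiagonal 3).over K) N.1, hP⟩ : {M : Submodule 𝒪[K] (Fin 3 → K) // IsVertex σ ϖ ((StdForm.antidiagonal 3).over K) M}) = L := Subtype.ext hp
    rw [hPL] at hd
    exact ⟨hd.symm, hp.symm⟩
  · right
    obtain ⟨hP, -, hd⟩ := dist_root_latticeParent_of_frames hσ hvσ hϖ hfr₀ hfr₂ L hL
    have hPN : (⟨latticeParent σ ϖ ((StdForm.antidiagonal 3).over K) L.1, hP⟩ : {M : Submodule 𝒪[K] (Fin 3 → K) // IsVertex σ ϖ ((StdForm.antidiagonal 3).over K) M}) = N := Subtype.ext hp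
    rw [hPN] at hd
    exact ⟨hd.symm, hL, hp.symm⟩

end Frames

/-! ## §2 Level algebra: `LEV(c)` passes to homothetic lattices, intersections and — for unitary `γ` fixing `M` — to the dual lattice -/

section Level

variable {N : ℕ}

/-- `LEV` is homothety-invariant: `(γ−1)M ≤ c·M ⇒ (γ−1)(a·M) ≤ c·(a·M)`. [cite: Serre1980Trees, II.1.1] [cite: Kottwitz1986, §3] -/
theorem map_scaleLattice_le_scaleLattice_of_map_le (X : Matrix (Fin N) (Fin N) K) (a c : K) {M : Submodule 𝒪[K] (Fin N → K)}
    (h : M.map ((Matrix.toLin' X).restrictScalars 𝒪[K]) ≤ scaleLattice c M) :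
    (scaleLattice a M).map ((Matrix.toLin' X).restrictScalars 𝒪[K]) ≤ scaleLattice c (scaleLattice a M) := by
  rw [← scaleLattice_map, scaleLattice_scaleLattice, mul_comm, ← scaleLattice_scaleLattice]
  exact scaleLattice_mono a h

/-- Scaling by a non-zero scalar commutes with intersections. [cite: Serre1980Trees, II.1.1] -/
theorem scaleLattice_inf {c : K} (hc : c ≠ 0) (A B : Submodule 𝒪[K] (Fin N → K)) : scaleLattice c (A ⊓ B) = scaleLattice c A ⊓ scaleLattice c B :=
  Submodule.map_inf _ (fun x y hxy => smul_right_injective (Fin N → K) hc (by simpa using hxy))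

/-- `LEV` passes to intersections: `(γ−1)A ≤ c·A`, `(γ−1)B ≤ c·B` ⇒ `(γ−1)(A ⊓ B) ≤ c·(A ⊓ B)` (`c ≠ 0`). [cite: Serre1980Trees, II.1.1] [cite: Kottwitz1986, §3] -/
theorem map_inf_le_scaleLattice_inf {c : K} (hc : c ≠ 0) (X : Matrix (Fin N) (Fin N) K) {A B : Submodule 𝒪[K] (Fin N → K)}
    (hA : A.map ((Matrix.toLin' X).restrictScalars 𝒪[K]) ≤ scaleLattice c A) (hB : B.map ((Matrix.toLin' X).restrictScalars 𝒪[K]) ≤ scaleLattice c B) :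
    (A ⊓ B).map ((Matrix.toLin' X).restrictScalars 𝒪[K]) ≤ scaleLattice c (A ⊓ B) := by
  rw [scaleLattice_inf hc]
  exact (Submodule.map_inf_le _).trans (inf_le_inf hA hB)

/-- **`LEV` PASSES TO THE DUAL LATTICE** for a UNITARY `γ` fixing `M`: `γ·M = M`, `(γ−1)M ≤ c·M` (`c ≠ 0`, `σ` isometric) ⇒ `(γ−1)M♯ ≤ c·M♯`.  For `y ∈ M♯`, `x ∈ M`:
`⟨x, (γ−1)y⟩ = ⟨(γ⁻¹−1)x, y⟩` (unitarity) and `(γ⁻¹−1)x = −(γ−1)(γ⁻¹x) ∈ c·M`, so `⟨x, c⁻¹(γ−1)y⟩ = c⁻¹σ(c)·⟨m, y⟩ ∈ 𝒪`. [cite: Jacobowitz1962, §4] [cite: Kottwitz1986, §3] -/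
theorem map_dualLatt_le_scaleLattice_of_mem_unitary (hvσ : ∀ a, Valued.v (σ a) = Valued.v a) {H : Matrix (Fin N) (Fin N) K} {γ : GL (Fin N) K}
    (hγ : γ ∈ unitaryGroupOfForm σ H) {c : K} (hc : c ≠ 0) {M : Submodule 𝒪[K] (Fin N → K)} (hfix : mapGL γ M = M)
    (h : M.map ((Matrix.toLin' ((γ : Matrix (Fin N) (Fin N) K) - 1)).restrictScalars 𝒪[K]) ≤ scaleLattice c M) :
    (dualLatt σ H M).map ((Matrix.toLin' ((γ : Matrix (Fin N) (Fin N) K) - 1)).restrictScalars 𝒪[K]) ≤ scaleLattice c (dualLatt σ H M) := by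
  rintro _ ⟨y, hy, rfl⟩
  rw [LinearMap.restrictScalars_apply, Matrix.toLin'_apply, mem_scaleLattice_iff hc, mem_dualLatt]
  intro x hx
  -- `x = γ x'` with `x' ∈ M`, and `(γ − 1) x' = c • m` with `m ∈ M`
  have hx' : ((γ⁻¹ : GL (Fin N) K) : Matrix (Fin N) (Fin N) K).mulVec x ∈ M := by rw [← mem_mapGL_iff, hfix]; exact hx
  set x' := ((γ⁻¹ : GL (Fin N) K) : Matrix (Fin N) (Fin N) K).mulVec x with hx'def
  have hγx' : (γ : Matrix (Fin N) (Fin N) K).mulVec x' = x := by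
    rw [hx'def, Matrix.mulVec_mulVec, ← Units.val_mul, mul_inv_cancel, Units.val_one, Matrix.one_mulVec]
  have hm : c⁻¹ • (((γ : Matrix (Fin N) (Fin N) K) - 1).mulVec x') ∈ M := by
    rw [← mem_scaleLattice_iff hc]
    exact h (Submodule.mem_map.2 ⟨x', hx', rfl⟩)
  set m := c⁻¹ • (((γ : Matrix (Fin N) (Fin N) K) - 1).mulVec x') with hmdef
  have hcm : ((γ : Matrix (Fin N) (Fin N) K) - 1).mulVec x' = c • m := by rw [hmdef, smul_smul, mul_inv_cancel₀ hc, one_smul]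
  -- `⟨x, (γ−1) y⟩ = ⟨γ⁻¹x − x, y⟩ = ⟨−(c • m), y⟩`
  have hkey : pairing σ H x (((γ : Matrix (Fin N) (Fin N) K) - 1).mulVec y) = pairing σ H (-(c • m)) y := by
    rw [Matrix.sub_mulVec, Matrix.one_mulVec, map_sub, ← hγx', pairing_mulVec_mulVec_of_mem_unitary hγ, ← LinearMap.sub_apply, ← map_sub,
      show x' - (γ : Matrix (Fin N) (Fin N) K).mulVec x' = -(c • m) by rw [← hcm, Matrix.sub_mulVec, Matrix.one_mulVec, neg_sub]]
  have hvc : Valued.v c ≠ 0 := (Valuation.ne_zero_iff _).2 hc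
  rw [map_smul, smul_eq_mul, hkey, LinearMap.map_neg₂, LinearMap.map_smulₛₗ, LinearMap.smul_apply, smul_eq_mul, mul_neg, Valuation.map_neg, map_mul, map_mul,
    map_inv₀, hvσ, ← mul_assoc, inv_mul_cancel₀ hvc, one_mul]
  exact (mem_dualLatt σ H M y).1 hy m hm

end Level

/-! ## §3 `LEV` is up-closed towards the root -/

section UpClosed

open scoped Classical

/-- **`LEV(c)` IS UP-CLOSED TOWARDS THE ROOT** (given the frames): `γ ∈ U(J₀)` with `LEV[r₀](c)`; `v` a fixed self-dual vertex, `w` a fixed self-dual vertex two steps FURTHER from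
the root through the fixed child `cc` of `v`; then `LEV[w](c) ⇒ LEV[v](c)`.  Route: `v = latticeParent cc = cc♯ ⊓ ϖ^e L₀` and `cc = latticeParent w = w ⊓ ϖ^e L₀`
(`e = 1 − depth w`, §1b), so `LEV[cc]` (§2, intersection), `LEV[cc♯]` (§2, duality) and `LEV[v]` (§2, intersection). [cite: Kottwitz1986, §3] [cite: Serre1980Trees, II.1.1] [cite: BruhatTits1972, §10] -/
theorem map_sub_one_le_scaleLattice_of_grandchild_of_frames (hσ : ∀ x, σ (σ x) = x) (hvσ : ∀ a, Valued.v (σ a) = Valued.v a) (hϖ : Valued.v ϖ = WithZero.exp (-1 : ℤ))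
    (hfr₀ : ∀ L : Submodule 𝒪[K] (Fin 3 → K), IsSelfDualLattice σ ϖ ((StdForm.antidiagonal 3).over K) L → ∃ κ : unitaryGroupOfForm σ ((StdForm.antidiagonal 3).over K), κ ∈ unitaryInt σ ((StdForm.antidiagonal 3).over K) ∧ ∃ a : ℤ, L = mapGL (κ : GL (Fin 3) K) (latt (Matrix.diagonal ![ϖ ^ a, 1, ϖ ^ (-a)])))
    (hfr₂ : ∀ M : Submodule 𝒪[K] (Fin 3 → K), IsVertexLattice σ ϖ ((StdForm.antidiagonal 3).over K) 2 M → ∃ κ : unitaryGroupOfForm σ ((StdForm.antidiagonal 3).over K), κ ∈ unitaryInt σ ((StdForm.antidiagonal 3).over K) ∧ ∃ κ'' : unitaryGroupOfForm σ ((StdForm.antidiagonal 3).over K), κ'' ∈ unitaryInt σ ((StdForm.antidiagonal 3).over K) ∧ ∃ a : ℕ, ∃ t : unitaryGroupOfForm σ ((StdForm.antidiagonal 3).over K), ((t : GL (Fin 3) K) : Matrix (Fin 3) (Fin 3) K) = Matrix.diagonal ![ϖ ^ (a : ℤ), 1, (σ ϖ) ^ (-(a : ℤ))] ∧ M = mapGL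 (κ : GL (Fin 3) K) (mapGL (t : GL (Fin 3) K) (mapGL (κ'' : GL (Fin 3) K) (latt (Matrix.diagonal ![(1 : K), 1, ϖ]))))) 
    {γ : unitaryGroupOfForm σ ((StdForm.antidiagonal 3).over K)} {c : K} (hc : c ≠ 0)
    (hroot : (stdLattice K 3).map ((Matrix.toLin' (((γ : GL (Fin 3) K) : Matrix (Fin 3) (Fin 3) K) - 1)).restrictScalars 𝒪[K]) ≤ scaleLattice c (stdLattice K 3))
    {v : {M : Submodule 𝒪[K] (Fin 3 → K) // IsVertex σ ϖ ((StdForm.antidiagonal 3).over K) M}} (hv : IsSelfDualLattice σ ϖ ((StdForm.antidiagonal 3).over K) v.1)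
    {w : {M : Submodule 𝒪[K] (Fin 3 → K) // IsVertex σ ϖ ((StdForm.antidiagonal 3).over K) M}} (hw : w ∈ {w | ∃ c, ((latticeGraph σ ϖ ((StdForm.antidiagonal 3).over K)).Adj v c ∧ (latticeGraph σ ϖ ((StdForm.antidiagonal 3).over K)).dist ⟨stdLattice K 3, 0, isSelfDualLattice_stdLattice_three_of_v hϖ⟩ c = (latticeGraph σ ϖ ((StdForm.antidiagonal 3).over K)).dist ⟨stdLattice K 3, 0, isSelfDualLattice_stdLattice_three_of_v hϖ⟩ v + 1 ∧ latticeGraphIso σ ϖ ((StdForm.antidiagonal 3).over K) γ c = c) ∧ ((latticeGraph σ ϖ ((StdForm.antidiagonal 3).over K)).Adj c w ∧ (latticeGraph σ ϖ ((StdForm.antidiagonal 3).over K)).dist ⟨stdLattice K 3, 0, isSelfDualLattice_stdLattice_three_of_v hϖ⟩ w = (latticeGraph σ ϖ ((StdForm.antidiagonal 3).over K)).dist ⟨stdLattice K 3, 0, isSelfDualLattice_stdLattice_three_of_v hϖ⟩ c + 1 ∧ latticeGraphIso σ ϖ ((StdForm.antidiagonal 3).over K) γ w = w)})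
    (hwR : w.1.map ((Matrix.toLin' (((γ : GL (Fin 3) K) : Matrix (Fin 3) (Fin 3) K) - 1)).restrictScalars 𝒪[K]) ≤ scaleLattice c w.1) :
    v.1.map ((Matrix.toLin' (((γ : GL (Fin 3) K) : Matrix (Fin 3) (Fin 3) K) - 1)).restrictScalars 𝒪[K]) ≤ scaleLattice c v.1 := by
  obtain ⟨cc, ⟨hvc, hdc, hfixc⟩, ⟨hcw, hdw, -⟩⟩ := hw
  -- types along the path `v ~ cc ~ w`
  have hltv : cc.1 < v.1 := (latticeGraph_adj_iff_lt_of_isSelfDualLattice_of_v hvσ hv).1 hvc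
  have hc2 : IsVertexLattice σ ϖ ((StdForm.antidiagonal 3).over K) 2 cc.1 := (isVertexLattice_two_and_isSelfDualLattice_of_lt_of_v hvσ hϖ cc.2 v.2 hltv).1
  have hltw : cc.1 < w.1 := (latticeGraph_adj_iff_gt_of_isVertexLattice_two_of_v hvσ hϖ hc2).1 hcw
  have hwsd : IsSelfDualLattice σ ϖ ((StdForm.antidiagonal 3).over K) w.1 := (isVertexLattice_two_and_isSelfDualLattice_of_lt_of_v hvσ hϖ cc.2 w.2 hltw).2
  -- the two parents, read with distances (§1b)
  have hvP : v.1 = latticeParent σ ϖ ((StdForm.antidiagonal 3).over K) cc.1 := by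
    rcases eq_latticeParent_of_lt_of_dist_of_frames hσ hvσ hϖ hfr₀ hfr₂ hltv with ⟨-, h⟩ | ⟨h, -, -⟩
    · exact h
    · omega
  have hcP : cc.1 = latticeParent σ ϖ ((StdForm.antidiagonal 3).over K) w.1 ∧ w.1 ≠ stdLattice K 3 := by
    rcases eq_latticeParent_of_lt_of_dist_of_frames hσ hvσ hϖ hfr₀ hfr₂ hltw with ⟨h, -⟩ | ⟨-, hw0, h⟩
    · omega
    · exact ⟨h, fun h0 => hw0 (Subtype.ext h0)⟩
  obtain ⟨hcP, hw0⟩ := hcP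
  -- `depth cc = depth w` (the parent of a self-dual vertex has the same depth)
  obtain ⟨-, -, -, hdep⟩ := latticeParent_spec_of_isSelfDualLattice_of_frames hσ hvσ hϖ hfr₀ hwsd hw0
  rw [← hcP] at hdep
  -- the scaled root `ϖ^e L₀`, `e = 1 − depth w`, carries `LEV(c)`
  have hS : (scaleLattice (ϖ ^ (1 - (latticeDepth ϖ w.1 : ℤ))) (stdLattice K 3)).map ((Matrix.toLin' (((γ : GL (Fin 3) K) : Matrix (Fin 3) (Fin 3) K) - 1)).restrictScalars 𝒪[K]) ≤
      scaleLattice c (scaleLattice (ϖ ^ (1 - (latticeDepth ϖ w.1 : ℤ))) (stdLattice K 3)) :=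
    map_scaleLattice_le_scaleLattice_of_map_le _ _ c hroot
  -- `cc = w ⊓ ϖ^e L₀` carries `LEV(c)`
  have hccE : cc.1 = w.1 ⊓ scaleLattice (ϖ ^ (1 - (latticeDepth ϖ w.1 : ℤ))) (stdLattice K 3) := by
    rw [hcP, latticeParent, dualLatt_eq_self_of_isSelfDualLattice hvσ isUnit_det_antidiagonal hwsd]
  have hcc : cc.1.map ((Matrix.toLin' (((γ : GL (Fin 3) K) : Matrix (Fin 3) (Fin 3) K) - 1)).restrictScalars 𝒪[K]) ≤ scaleLattice c cc.1 := by
    rw [hccE]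
    exact map_inf_le_scaleLattice_inf hc _ hwR hS
  -- `cc♯` carries `LEV(c)` (duality; `γ cc = cc`)
  have hfixc' : mapGL (γ : GL (Fin 3) K) cc.1 = cc.1 := (latticeGraphIso_eq_iff_mapGL_eq γ cc).1 hfixc
  have hdual := map_dualLatt_le_scaleLattice_of_mem_unitary hvσ γ.2 hc hfixc' hcc
  -- `v = cc♯ ⊓ ϖ^e L₀`
  have hvE : v.1 = dualLatt σ ((StdForm.antidiagonal 3).over K) cc.1 ⊓ scaleLattice (ϖ ^ (1 - (latticeDepth ϖ w.1 : ℤ))) (stdLattice K 3) := by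
    rw [hvP, latticeParent, hdep]
  rw [hvE]
  exact map_inf_le_scaleLattice_inf hc _ hdual hS

end UpClosed

/-! ## §4 The root token from the eigenframe, and the socket S1 `row_regionUpClosed` of the junction (tame-ramified, frames discharged) -/

section Socket

open scoped Classical

omit [Valued K ℤᵐ⁰] in
/-- `γ − 1 = A·diag(s − 1)·A⁻¹` for `γ = A·diag(s)·A⁻¹`. [cite: Tits1979, §3.5] -/
theorem sub_one_eq_conj_diagonal_sub_one (A : GL (Fin 3) K) (s : Fin 3 → K) {γm : Matrix (Fin 3) (Fin 3) K}
    (hγA : γm = (A : Matrix (Fin 3) (Fin 3) K) * Matrix.diagonal s * ((A⁻¹ : GL (Fin 3) K) : Matrix (Fin 3) (Fin 3) K)) :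
    γm - 1 = (A : Matrix (Fin 3) (Fin 3) K) * Matrix.diagonal (fun i => s i - 1) * ((A⁻¹ : GL (Fin 3) K) : Matrix (Fin 3) (Fin 3) K) := by
  have hAA : (A : Matrix (Fin 3) (Fin 3) K) * ((A⁻¹ : GL (Fin 3) K) : Matrix (Fin 3) (Fin 3) K) = 1 := by rw [← Units.val_mul, mul_inv_cancel, Units.val_one]
  have hdiag : Matrix.diagonal (fun i => s i - 1) = Matrix.diagonal s - 1 := by rw [← Matrix.diagonal_one, Matrix.diagonal_sub]
  rw [hγA, hdiag, Matrix.mul_sub, Matrix.sub_mul, Matrix.mul_one, hAA]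

/-- **THE ROOT TOKEN FROM THE EIGENFRAME**: if `γ = A·diag(s)·A⁻¹` with `A, A⁻¹` integral and `|s_i − 1| ≤ |t|` (`t ≠ 0`), then `(γ − 1)·𝒪³ ≤ t·𝒪³`, i.e. `LEV[r₀](t)`.
[cite: Kottwitz1986, §3] [cite: Tits1979, §3.5] -/
theorem map_sub_one_stdLattice_le_scaleLattice_of_eigenframe (A : GL (Fin 3) K) (hA : IsIntMatrix (A : Matrix (Fin 3) (Fin 3) K)) (hA' : IsIntMatrix ((A⁻¹ : GL (Fin 3) K) : Matrix (Fin 3) (Fin 3) K))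
    (s : Fin 3 → K) {γm : Matrix (Fin 3) (Fin 3) K} (hγA : γm = (A : Matrix (Fin 3) (Fin 3) K) * Matrix.diagonal s * ((A⁻¹ : GL (Fin 3) K) : Matrix (Fin 3) (Fin 3) K))
    {t : K} (ht : t ≠ 0) (he : ∀ i, Valued.v (s i - 1) ≤ Valued.v t) :
    (stdLattice K 3).map ((Matrix.toLin' (γm - 1)).restrictScalars 𝒪[K]) ≤ scaleLattice t (stdLattice K 3) := by
  have hentry : ∀ i j, Valued.v ((γm - 1) i j) ≤ Valued.v t := by
    intro i j
    rw [sub_one_eq_conj_diagonal_sub_one A s hγA, Matrix.mul_apply]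
    refine Valuation.map_sum_le _ fun m _ => ?_
    rw [map_mul, Matrix.mul_apply]
    calc Valued.v (∑ l, (A : Matrix (Fin 3) (Fin 3) K) i l * Matrix.diagonal (fun i => s i - 1) l m) * Valued.v (((A⁻¹ : GL (Fin 3) K) : Matrix (Fin 3) (Fin 3) K) m j) ≤ Valued.v t * 1 :=
          mul_le_mul' (Valuation.map_sum_le _ fun l _ => by
            rw [map_mul]
            calc Valued.v ((A : Matrix (Fin 3) (Fin 3) K) i l) * Valued.v (Matrix.diagonal (fun i => s i - 1) l m) ≤ 1 * Valued.v t :=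
                  mul_le_mul' (hA i l) (by
                    by_cases hlm : l = m
                    · subst hlm; rw [Matrix.diagonal_apply_eq]; exact he l
                    · rw [Matrix.diagonal_apply_ne _ hlm, map_zero]; exact zero_le)
              _ = Valued.v t := one_mul _) (hA' m j)
      _ = Valued.v t := mul_one _
  rintro _ ⟨x, hx, rfl⟩
  rw [LinearMap.restrictScalars_apply, Matrix.toLin'_apply, mem_scaleLattice_stdLattice_iff ht]
  intro i
  rw [Matrix.mulVec, dotProduct]
  refine Valuation.map_sum_le _ fun j _ => ?_
  rw [map_mul]
  calc Valued.v ((γm - 1) i j) * Valued.v (x j) ≤ Valued.v t * 1 := mul_le_mul' (hentry i j) (mem_stdLattice.1 hx j)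
    _ = Valued.v t := mul_one _

/-- **S1 «THE REGION IS UP-CLOSED» — the socket `row_regionUpClosed` of the junction skeleton v4 (J-PACK v2-iso, F0P3a-p01 (g17)), binders verbatim plus the extra
hypothesis `hnorm` (first-order norm surjectivity on `σ`-fixed one-units, the tree's own binder in ★ `isTree_latticeGraph_three_of_neg`) and the instance binders
`[ValuativeRel K] [Valued.v.Compatible]` of the Cartan frames (★ `exists_frame_mapGL_stdLattice`; the junction's assembly `strataCount_J₀_…` carries them) — announced on the bus.**
Tame-ramified `K ∕ K^σ` (`σϖ = −ϖ`, `hres`, `|2| = 1`, `hnorm`); `γ = A·diag(s)·A⁻¹` with `A ∈ GL₃(𝒪)` and `|s_i − 1| ≤ |ϖ|^{d₀}`; `v` a fixed self-dual vertex and `w` a fixed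
self-dual vertex two steps further from `r₀` through a fixed child of `v`.  THEN `LEV[w](ϖ^{d₀}) ⇒ LEV[v](ϖ^{d₀})`: the region `R = {LEV(ϖ^{d₀})}` is up-closed (convex towards
the root).  Proof = §4 root token + §3 with the frames discharged by ★ `exists_frame_mapGL_stdLattice` ∕ ★ `exists_frame_mapGL_N₁` over the transitivity ★
`exists_unitary_mapGL_stdLattice_eq_of_isSelfDualLattice_of_v_two` ∕ ★ `forall_isVertexLattice_two_exists_mapGL_N₁_eq_of_neg`.  (The `_`-binders — tree, `γ ∈ K₀`, the form frame
`d`, the isoceles eigen-data `i₀`, `hd3`, `hiso`, `hclose` — are part of the socket and unused: the statement holds for every `γ ∈ U(J₀)` at root level `ϖ^{d₀}`.)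
[cite: Kottwitz1986, §3] [cite: BruhatTits1972, §10] [cite: Serre1980Trees, II.1.1] [cite: Tits1979, §2.4, §3.5] -/
theorem row_regionUpClosed_of_neg (hσ : ∀ x, σ (σ x) = x) (hvσ : ∀ a, Valued.v (σ a) = Valued.v a) (hσϖ : σ ϖ = -ϖ)
    (hϖ : Valued.v ϖ = WithZero.exp (-1 : ℤ)) (hres : ∀ x : K, Valued.v x ≤ 1 → Valued.v (σ x - x) < 1) (h2 : Valued.v (2 : K) = 1)
    (hnorm : ∀ u : K, σ u = u → Valued.v (u - 1) < 1 → ∃ z : K, z * σ z = u ∧ Valued.v (z - 1) ≤ Valued.v (u - 1)) [Finite 𝓀[K]]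
    [ValuativeRel K] [(Valued.v : Valuation K ℤᵐ⁰).Compatible]
    (_hT : (latticeGraph σ ϖ ((StdForm.antidiagonal 3).over K)).IsTree)
    {γ : unitaryGroupOfForm σ ((StdForm.antidiagonal 3).over K)} (_hγ0 : γ ∈ unitaryInt σ ((StdForm.antidiagonal 3).over K))
    (d : Fin 3 → K) (_hd : ∀ i, Valued.v (d i) = 1) (_hdσ : ∀ i, σ (d i) = d i)
    (A : GL (Fin 3) K) (hA : IsIntMatrix (A : Matrix (Fin 3) (Fin 3) K)) (hA' : IsIntMatrix ((A⁻¹ : GL (Fin 3) K) : Matrix (Fin 3) (Fin 3) K))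
    (_hdA : Matrix.diagonal d = (-(Matrix.diagonal d).det) • formCongr σ A ((StdForm.antidiagonal 3).over K))
    (s : Fin 3 → K) (_hs1 : s 1 = 1) (_hsv : ∀ i, Valued.v (s i) = 1) (_hsσ : ∀ i, s i * σ (s i) = 1)
    (hγA : ((γ : GL (Fin 3) K) : Matrix (Fin 3) (Fin 3) K) = (A : Matrix (Fin 3) (Fin 3) K) * Matrix.diagonal s * ((A⁻¹ : GL (Fin 3) K) : Matrix (Fin 3) (Fin 3) K))
    (i₀ : Fin 3) {d₀ : ℕ} (_hd3 : 3 ≤ d₀) (he : ∀ i, Valued.v (s i - 1) ≤ Valued.v ϖ ^ d₀)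
    (_hiso : ∀ j, j ≠ i₀ → Valued.v (s i₀ - s j) = Valued.v ϖ ^ d₀) (_hclose : ∀ j k, j ≠ i₀ → k ≠ i₀ → Valued.v (s j - s k) ≤ Valued.v ϖ ^ (d₀ + 2))
    {v : {M : Submodule 𝒪[K] (Fin 3 → K) // IsVertex σ ϖ ((StdForm.antidiagonal 3).over K) M}} (hv : IsSelfDualLattice σ ϖ ((StdForm.antidiagonal 3).over K) v.1) (_hfix : latticeGraphIso σ ϖ ((StdForm.antidiagonal 3).over K) γ v = v)
    {w : {M : Submodule 𝒪[K] (Fin 3 → K) // IsVertex σ ϖ ((StdForm.antidiagonal 3).over K) M}} (hw : w ∈ {w | ∃ c, ((latticeGraph σ ϖ ((StdForm.antidiagonal 3).over K)).Adj v c ∧ (latticeGraph σ ϖ ((StdForm.antidiagonal 3).over K)).dist ⟨stdLattice K 3, 0, isSelfDualLattice_stdLattice_three_of_v hϖ⟩ c = (latticeGraph σ ϖ ((StdForm.antidiagonal 3).over K)).dist ⟨stdLattice K 3, 0, isSelfDualLattice_stdLattice_three_of_v hϖ⟩ v + 1 ∧ latticeGraphIso σ ϖ ((StdForm.antidiagonal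 3).over K) γ c = c) ∧ ((latticeGraph σ ϖ ((StdForm.antidiagonal 3).over K)).Adj c w ∧ (latticeGraph σ ϖ ((StdForm.antidiagonal 3).over K)).dist ⟨stdLattice K 3, 0, isSelfDualLattice_stdLattice_three_of_v hϖ⟩ w = (latticeGraph σ ϖ ((StdForm.antidiagonal 3).over K)).dist ⟨stdLattice K 3, 0, isSelfDualLattice_stdLattice_three_of_v hϖ⟩ c + 1 ∧ latticeGraphIso σ ϖ ((StdForm.antidiagonal 3).over K) γ w = w)})
    (hwR : w.1.map ((Matrix.toLin' (((γ : GL (Fin 3) K) : Matrix (Fin 3) (Fin 3) K) - 1)).restrictScalars 𝒪[K]) ≤ scaleLattice (ϖ ^ d₀) w.1) :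
    v.1.map ((Matrix.toLin' (((γ : GL (Fin 3) K) : Matrix (Fin 3) (Fin 3) K) - 1)).restrictScalars 𝒪[K]) ≤ scaleLattice (ϖ ^ d₀) v.1 := by
  have hϖ0 : ϖ ≠ 0 := uniformizer_ne_zero hϖ
  have hc : ϖ ^ d₀ ≠ 0 := pow_ne_zero _ hϖ0
  have hroot := map_sub_one_stdLattice_le_scaleLattice_of_eigenframe A hA hA' s hγA hc (fun i => by rw [map_pow]; exact he i)
  refine map_sub_one_le_scaleLattice_of_grandchild_of_frames hσ hvσ hϖ (fun L hL => ?_) (fun M hM => ?_) hc hroot hv hw hwR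
  · obtain ⟨u, rfl⟩ := exists_unitary_mapGL_stdLattice_eq_of_isSelfDualLattice_of_v_two hσ hvσ hϖ h2 hL
    exact exists_frame_mapGL_stdLattice hσ hvσ hϖ u
  · obtain ⟨u, rfl⟩ := forall_isVertexLattice_two_exists_mapGL_N₁_eq_of_neg hσ hvσ hϖ hσϖ hres h2 hnorm M hM
    exact exists_frame_mapGL_N₁ hσ hvσ hϖ u

end Socket

/-! ## §5 (ED. 2) ORIENTATION: the inward far vertex of a fixed self-dual vertex carries its level (the `∃`-clause of the junction's L2 `orientation_of_rows`) -/

section Orientation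

open scoped Classical

/-- **ORIENTATION (frames form)**: `γ ∈ U(J₀)` fixing the root with `LEV[r₀](c)`, `v ≠ r₀` a fixed self-dual vertex with `LEV[v](c)`; then its parent `p = latticeParent v`
(the inward neighbour: `dist(r₀, p) + 1 = dist(r₀, v)`) and grandparent `g = latticeParent p ≠ v` satisfy `v ~ p ~ g` and **`LEV[g](c)`** — §3 up-closedness applied to the
triple `(g, p, v)`, `p` being `γ`-fixed by ★ `parentClosed_fixedPoints`.  This is the `∃ p g` clause of the junction's L2 `orientation_of_rows` with `c = ϖ^{dep v}` (the
`hup` binder of ROW-C∕R∕E∕O∕P), free of any row. [cite: Serre1980Trees, I.2.3, II.1.1] [cite: Kottwitz1986, §3] [cite: BruhatTits1972, §10] -/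
theorem exists_parent_grandparent_lev_of_frames (hσ : ∀ x, σ (σ x) = x) (hvσ : ∀ a, Valued.v (σ a) = Valued.v a) (hϖ : Valued.v ϖ = WithZero.exp (-1 : ℤ))
    (hfr₀ : ∀ L : Submodule 𝒪[K] (Fin 3 → K), IsSelfDualLattice σ ϖ ((StdForm.antidiagonal 3).over K) L → ∃ κ : unitaryGroupOfForm σ ((StdForm.antidiagonal 3).over K), κ ∈ unitaryInt σ ((StdForm.antidiagonal 3).over K) ∧ ∃ a : ℤ, L = mapGL (κ : GL (Fin 3) K) (latt (Matrix.diagonal ![ϖ ^ a, 1, ϖ ^ (-a)])))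
    (hfr₂ : ∀ M : Submodule 𝒪[K] (Fin 3 → K), IsVertexLattice σ ϖ ((StdForm.antidiagonal 3).over K) 2 M → ∃ κ : unitaryGroupOfForm σ ((StdForm.antidiagonal 3).over K), κ ∈ unitaryInt σ ((StdForm.antidiagonal 3).over K) ∧ ∃ κ'' : unitaryGroupOfForm σ ((StdForm.antidiagonal 3).over K), κ'' ∈ unitaryInt σ ((StdForm.antidiagonal 3).over K) ∧ ∃ a : ℕ, ∃ t : unitaryGroupOfForm σ ((StdForm.antidiagonal 3).over K), ((t : GL (Fin 3) K) : Matrix (Fin 3) (Fin 3) K) = Matrix.diagonal ![ϖ ^ (a : ℤ), 1, (σ ϖ) ^ (-(a : ℤ))] ∧ M = mapGL (κ : GL (Fin 3) K) (mapGL (t : GL (Fin 3) K) (mapGL (κ'' : GL (Fin 3) K) (latt (Matrix.diagonal ![(1 : K), 1, ϖ]))))) 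
    (hT : (latticeGraph σ ϖ ((StdForm.antidiagonal 3).over K)).IsTree)
    {γ : unitaryGroupOfForm σ ((StdForm.antidiagonal 3).over K)} (hγr : latticeGraphIso σ ϖ ((StdForm.antidiagonal 3).over K) γ ⟨stdLattice K 3, 0, isSelfDualLattice_stdLattice_three_of_v hϖ⟩ = ⟨stdLattice K 3, 0, isSelfDualLattice_stdLattice_three_of_v hϖ⟩)
    {c : K} (hc : c ≠ 0)
    (hroot : (stdLattice K 3).map ((Matrix.toLin' (((γ : GL (Fin 3) K) : Matrix (Fin 3) (Fin 3) K) - 1)).restrictScalars 𝒪[K]) ≤ scaleLattice c (stdLattice K 3))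
    {v : {M : Submodule 𝒪[K] (Fin 3 → K) // IsVertex σ ϖ ((StdForm.antidiagonal 3).over K) M}} (hv : IsSelfDualLattice σ ϖ ((StdForm.antidiagonal 3).over K) v.1)
    (hvr : v ≠ ⟨stdLattice K 3, 0, isSelfDualLattice_stdLattice_three_of_v hϖ⟩) (hfix : latticeGraphIso σ ϖ ((StdForm.antidiagonal 3).over K) γ v = v)
    (hlev : v.1.map ((Matrix.toLin' (((γ : GL (Fin 3) K) : Matrix (Fin 3) (Fin 3) K) - 1)).restrictScalars 𝒪[K]) ≤ scaleLattice c v.1) :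
    ∃ p g : {M : Submodule 𝒪[K] (Fin 3 → K) // IsVertex σ ϖ ((StdForm.antidiagonal 3).over K) M},
      (latticeGraph σ ϖ ((StdForm.antidiagonal 3).over K)).Adj v p ∧
      (latticeGraph σ ϖ ((StdForm.antidiagonal 3).over K)).dist ⟨stdLattice K 3, 0, isSelfDualLattice_stdLattice_three_of_v hϖ⟩ p + 1 =
        (latticeGraph σ ϖ ((StdForm.antidiagonal 3).over K)).dist ⟨stdLattice K 3, 0, isSelfDualLattice_stdLattice_three_of_v hϖ⟩ v ∧
      (latticeGraph σ ϖ ((StdForm.antidiagonal 3).over K)).Adj p g ∧ g ≠ v ∧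
      g.1.map ((Matrix.toLin' (((γ : GL (Fin 3) K) : Matrix (Fin 3) (Fin 3) K) - 1)).restrictScalars 𝒪[K]) ≤ scaleLattice c g.1 := by
  -- no lattice is both self-dual and of type two
  have hnot : ∀ M : Submodule 𝒪[K] (Fin 3 → K), IsVertexLattice σ ϖ ((StdForm.antidiagonal 3).over K) 2 M → ¬ IsSelfDualLattice σ ϖ ((StdForm.antidiagonal 3).over K) M :=
    fun M h2 h0 => absurd (type_unique hvσ hϖ h2 h0) (by norm_num)
  have hv0 : v.1 ≠ stdLattice K 3 := fun h => hvr (Subtype.ext h)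
  -- the parent `p` (type two, inward, fixed)
  obtain ⟨hP, hvp, hdp⟩ := dist_root_latticeParent_of_frames hσ hvσ hϖ hfr₀ hfr₂ v hvr
  obtain ⟨-, hP2, -, -⟩ := latticeParent_spec_of_isSelfDualLattice_of_frames hσ hvσ hϖ hfr₀ hv hv0
  set p : {M : Submodule 𝒪[K] (Fin 3 → K) // IsVertex σ ϖ ((StdForm.antidiagonal 3).over K) M} := ⟨latticeParent σ ϖ ((StdForm.antidiagonal 3).over K) v.1, hP⟩ with hpdef
  have hpr : p ≠ ⟨stdLattice K 3, 0, isSelfDualLattice_stdLattice_three_of_v hϖ⟩ := fun h =>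
    hnot _ hP2 (by rw [show latticeParent σ ϖ ((StdForm.antidiagonal 3).over K) v.1 = stdLattice K 3 from congrArg Subtype.val h]; exact isSelfDualLattice_stdLattice_three_of_v hϖ)
  have hfixp : latticeGraphIso σ ϖ ((StdForm.antidiagonal 3).over K) γ p = p :=
    Literature.Combinatorics.SimpleGraph.TreeLayers.parentClosed_fixedPoints hT _ (latticeGraphIso σ ϖ ((StdForm.antidiagonal 3).over K) γ) hγr v hfix hvr p hvp hdp
  -- the grandparent `g` (self-dual, inward of `p`)
  obtain ⟨hG, hpg, hdg⟩ := dist_root_latticeParent_of_frames hσ hvσ hϖ hfr₀ hfr₂ p hpr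
  obtain ⟨hG0, -, -⟩ := latticeParent_spec_of_isVertexLattice_two_of_frames hσ hvσ hϖ hfr₂ hP2
  set g : {M : Submodule 𝒪[K] (Fin 3 → K) // IsVertex σ ϖ ((StdForm.antidiagonal 3).over K) M} := ⟨latticeParent σ ϖ ((StdForm.antidiagonal 3).over K) p.1, hG⟩ with hgdef
  have hgv : g ≠ v := by
    intro h
    rw [h] at hdg
    omega
  refine ⟨p, g, hvp, hdp, hpg, hgv, ?_⟩
  -- §3 at the triple `(g, p, v)`
  exact map_sub_one_le_scaleLattice_of_grandchild_of_frames hσ hvσ hϖ hfr₀ hfr₂ hc hroot (v := g) (w := v) hG0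
    ⟨p, ⟨hpg.symm, by omega, hfixp⟩, ⟨hvp.symm, by omega, hfix⟩⟩ hlev

/-- **ORIENTATION, tame-ramified, eigenframe form** (frames discharged; root token from `γ = A·diag(s)·A⁻¹`, `A ∈ GL₃(𝒪)`, `|s_i − 1| ≤ |ϖ|^e`): for `γ ∈ K₀` and a fixed
self-dual `v ≠ r₀` with `LEV[v](ϖ^e)` there are the inward neighbour `p` (`dist(r₀, p) + 1 = dist(r₀, v)`) and a far vertex `g ≠ v` through `p` with `LEV[g](ϖ^e)` — the
`∃`-clause of the junction's L2 `orientation_of_rows` at `e := dep v` (its `he` is `|s_i − 1| = |ϖ|^N ≤ |ϖ|^{dep v}` from `dep v ≤ N`).  Extra binders as in S1: `hnorm`,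
`[ValuativeRel K] [Valued.v.Compatible]`. [cite: Serre1980Trees, I.2.3, II.1.1] [cite: Kottwitz1986, §3] [cite: Tits1979, §3.5] -/
theorem exists_parent_grandparent_lev_of_neg (hσ : ∀ x, σ (σ x) = x) (hvσ : ∀ a, Valued.v (σ a) = Valued.v a) (hσϖ : σ ϖ = -ϖ)
    (hϖ : Valued.v ϖ = WithZero.exp (-1 : ℤ)) (hres : ∀ x : K, Valued.v x ≤ 1 → Valued.v (σ x - x) < 1) (h2 : Valued.v (2 : K) = 1)
    (hnorm : ∀ u : K, σ u = u → Valued.v (u - 1) < 1 → ∃ z : K, z * σ z = u ∧ Valued.v (z - 1) ≤ Valued.v (u - 1))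
    [ValuativeRel K] [(Valued.v : Valuation K ℤᵐ⁰).Compatible]
    (hT : (latticeGraph σ ϖ ((StdForm.antidiagonal 3).over K)).IsTree)
    {γ : unitaryGroupOfForm σ ((StdForm.antidiagonal 3).over K)} (hγ0 : γ ∈ unitaryInt σ ((StdForm.antidiagonal 3).over K))
    (A : GL (Fin 3) K) (hA : IsIntMatrix (A : Matrix (Fin 3) (Fin 3) K)) (hA' : IsIntMatrix ((A⁻¹ : GL (Fin 3) K) : Matrix (Fin 3) (Fin 3) K))
    (s : Fin 3 → K) (hγA : ((γ : GL (Fin 3) K) : Matrix (Fin 3) (Fin 3) K) = (A : Matrix (Fin 3) (Fin 3) K) * Matrix.diagonal s * ((A⁻¹ : GL (Fin 3) K) : Matrix (Fin 3) (Fin 3) K))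
    {e : ℕ} (he : ∀ i, Valued.v (s i - 1) ≤ Valued.v ϖ ^ e)
    {v : {M : Submodule 𝒪[K] (Fin 3 → K) // IsVertex σ ϖ ((StdForm.antidiagonal 3).over K) M}} (hv : IsSelfDualLattice σ ϖ ((StdForm.antidiagonal 3).over K) v.1)
    (hvr : v ≠ ⟨stdLattice K 3, 0, isSelfDualLattice_stdLattice_three_of_v hϖ⟩) (hfix : latticeGraphIso σ ϖ ((StdForm.antidiagonal 3).over K) γ v = v)
    (hlev : v.1.map ((Matrix.toLin' (((γ : GL (Fin 3) K) : Matrix (Fin 3) (Fin 3) K) - 1)).restrictScalars 𝒪[K]) ≤ scaleLattice (ϖ ^ e) v.1) :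
    ∃ p g : {M : Submodule 𝒪[K] (Fin 3 → K) // IsVertex σ ϖ ((StdForm.antidiagonal 3).over K) M},
      (latticeGraph σ ϖ ((StdForm.antidiagonal 3).over K)).Adj v p ∧
      (latticeGraph σ ϖ ((StdForm.antidiagonal 3).over K)).dist ⟨stdLattice K 3, 0, isSelfDualLattice_stdLattice_three_of_v hϖ⟩ p + 1 =
        (latticeGraph σ ϖ ((StdForm.antidiagonal 3).over K)).dist ⟨stdLattice K 3, 0, isSelfDualLattice_stdLattice_three_of_v hϖ⟩ v ∧
      (latticeGraph σ ϖ ((StdForm.antidiagonal 3).over K)).Adj p g ∧ g ≠ v ∧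
      g.1.map ((Matrix.toLin' (((γ : GL (Fin 3) K) : Matrix (Fin 3) (Fin 3) K) - 1)).restrictScalars 𝒪[K]) ≤ scaleLattice (ϖ ^ e) g.1 := by
  have hϖ0 : ϖ ≠ 0 := uniformizer_ne_zero hϖ
  have hc : ϖ ^ e ≠ 0 := pow_ne_zero _ hϖ0
  have hroot := map_sub_one_stdLattice_le_scaleLattice_of_eigenframe A hA hA' s hγA hc (fun i => by rw [map_pow]; exact he i)
  have hγr : latticeGraphIso σ ϖ ((StdForm.antidiagonal 3).over K) γ ⟨stdLattice K 3, 0, isSelfDualLattice_stdLattice_three_of_v hϖ⟩ = ⟨stdLattice K 3, 0, isSelfDualLattice_stdLattice_three_of_v hϖ⟩ :=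
    (latticeGraphIso_eq_iff_mapGL_eq γ _).2 (mapGL_stdLattice_of_mem_unitaryInt hγ0)
  refine exists_parent_grandparent_lev_of_frames hσ hvσ hϖ (fun L hL => ?_) (fun M hM => ?_) hT hγr hc hroot hv hvr hfix hlev
  · obtain ⟨u, rfl⟩ := exists_unitary_mapGL_stdLattice_eq_of_isSelfDualLattice_of_v_two hσ hvσ hϖ h2 hL
    exact exists_frame_mapGL_stdLattice hσ hvσ hϖ u
  · obtain ⟨u, rfl⟩ := forall_isVertexLattice_two_exists_mapGL_N₁_eq_of_neg hσ hvσ hϖ hσϖ hres h2 hnorm M hM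
    exact exists_frame_mapGL_N₁ hσ hvσ hϖ u

end Orientation

end Literature.NumberTheory.Automorphic.UnitaryLatticeTree

end
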